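import Literature.Topology.FourManifolds.KnotFraming
import Literature.Topology.FourManifolds.KnotTube
import Literature.Topology.FourManifolds.KnotGroupTubular
import HarnessLib

/-!
# Tubular neighbourhoods of smooth knots; knot groups are finitely generated; `Δ_K(1) = ±1`

Sibling proof file of `KnotTube.lean` (D-0014: named facts `def X : Prop` are discharged as
`theorem X_holds : X`, bottom-up). It completes the chain

`KnotFraming.lean` (framings) → `KnotTube.lean` (local analysis of the radial tube map) → **this
file** (global injectivity, descent to `S¹ × ℝ²`, the topological tube of a knot) →
`KnotGroupTubular.lean` (`fundamentalGroup_fg_compl_range_of_tube`: the complement of the core of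
a topological tube in `S³` has finitely generated `π₁`) → `KnotGroupProofs.lean`
(`isUnit_eval_one_of_fg_group`) → `AlexanderModuleTrivializer.lean` (Crowell–Fox Ch. IX (1.2)),

and thereby **discharges two named facts**:

* `Literature.Knot.fg_group_holds : Knot.fg_group` — the knot group `π₁(S³ ∖ K)` of every smooth knot is
  finitely generated (Crowell–Fox, Ch. VI (2.5) with Ch. I (2.1));
* `Literature.Knot.IsAlexanderPolynomial.isUnit_eval_one_holds :
    Knot.IsAlexanderPolynomial.isUnit_eval_one` — every Alexander polynomial of a smooth knot
  satisfies `Δ_K(1) = ±1` (Crowell–Fox, Ch. IX (1.1)–(1.2); Rolfsen, *Knots and Links* (1976),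
  §8.D, the locator of the vendored fact).

## The tube theorem

**Theorem** (`Literature.Topology.FourManifolds.Knot.exists_tube`). Every smooth knot `K : S¹ → S³` is the core of a topological
tube: there is a continuous injective open map `ν : S¹ × ℝ² → S³` with `ν (z, 0) = K z`.

*Proof.* Let `k = K.curve : ℝ → ℝ⁴` (unit period, regular, `KnotFraming.lean`) with normal framing
`n₁, n₂` (`exists_normal_framing`), and let `F = tubeProj : (t, u) ↦ (k + u₀n₁ + u₁n₂)/‖…‖`
(`KnotTube.lean`). By `KnotTube.lean` there is a slab `ℝ × B(0, ε₀)` on which `F` is open into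
`S³` and locally injective. **Global injectivity modulo `ℤ`** on a thinner slab
(`IsFramedCurve.exists_isTubeRadius`): (i) a Lebesgue number `δ` of the local-injectivity cover of
`[0, 1] × {0}` makes `F` injective on every box `(s - δ, s + δ) × B(0, δ)` (`exists_injOn_ball`);
(ii) by compactness of `{(s, s') ∈ [0, 1] × ℝ : δ ≤ |s - s'| ≤ 1/2}`, on which `k s ≠ k s'`
(`K` injective, `circlePt` identifies exactly modulo `ℤ`), there is `η > 0` with
`|s - s'| ≤ 1/2, ‖k s - k s'‖ < η ⟹ |s - s'| < δ` (`exists_abs_sub_lt`); (iii) by the tube lemma,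
`‖F(t, u) - k t‖ < η/2` for `‖u‖ < ε₁` (`exists_forall_norm_tubeProj_sub_lt`). If now
`F(t₁, u₁) = F(t₂, u₂)` with `‖uᵢ‖ < min(ε₀, δ, ε₁)`, shift `t₂` by an integer into
`[t₁ - 1/2, t₁ + 1/2)` (`toIcoMod`); then `‖k t₁ - k t₂‖ < η`, so `|t₁ - t₂| < δ`, so
`(t₁, u₁) = (t₂, u₂)` by (i). **Descent** (`IsTubeRadius.*`): `tubeMap (z, u) = F (angA z, φ u)`
with `φ = univBall 0 ε : ℝ² ≅ B(0, ε)`; it is injective by the above, continuous because near any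
`z` one of the sections `angA`, `angB` of `circlePt` is continuous and `F` is `ℤ`-periodic, and open
into `S³` because `(s, v) ↦ (circlePt s, φ⁻¹ v)` is a continuous local inverse of the
parametrisation through which neighbourhoods pull back (`KnotTube.lean`,
`exists_nhds_inter_sphere_subset_image`). Viewing the values in the subtype `S³` gives `ν`
(`IsFramedCurve.exists_tube`), with `ν (z, 0) = k (angA z) = K z`.

This is the topological content of the tubular neighbourhood theorem for knots (Hirsch,
*Differential Topology* (1976), §4.5); the smooth, orientation-compatible
version is the (still undischarged, no longer needed here) named fact
`Literature.Topology.FourManifolds.Knot.nonempty_tubularNbhd` of `DehnSurgery.lean`.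

## Sources

R. H. Crowell, R. H. Fox, *Introduction to Knot Theory* (1963; GTM 57, 1977), Ch. VI (2.5), Ch. IX
(1.1)–(1.2); D. Rolfsen, *Knots and Links* (1976), §8.D (as cited by `KnotGroup.lean`);
M. W. Hirsch, *Differential Topology* (1976), §4.5. The elementary tube construction is
folklore. No definitions or named facts are introduced; everything is proved.
-/

open scoped Manifold ContDiff Topology Real RealInnerProductSpace
open Set Function Metric Filter

noncomputable section

namespace Literature.Topology.FourManifolds

/-! ## Tube radii exist for embedded framed curves -/

section TubeRadius

variable {k n₁ n₂ : ℝ → EuclideanSpace ℝ (Fin 4)}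

namespace IsFramedCurve

variable (h : IsFramedCurve k n₁ n₂)
include h

/-- A framed curve is `ℤ`-periodic: `k (t + m) = k t`. [folklore] -/
theorem apply_add_int (t : ℝ) (m : ℤ) : k (t + m) = k t := by
  have := (h.periodic.int_mul m) t
  rwa [mul_one] at this

/-- **Uniform local injectivity along the core.** There is `δ > 0` such that the radial tube map is
injective on every box `(s - δ, s + δ) × B(0, δ)`: a Lebesgue number of the cover of
`[0, 1] × {0}` by the local-injectivity neighbourhoods of `exists_injOn_tubeProj`, spread to all
`s ∈ ℝ` by `ℤ`-periodicity. [folklore] -/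
theorem exists_injOn_ball :
    ∃ δ > 0, ∀ s : ℝ,
      InjOn (tubeProj k n₁ n₂) (ball ((s, 0) : ℝ × EuclideanSpace ℝ (Fin 2)) δ) := by
  choose W hW hWinj using fun s : ℝ => h.exists_injOn_tubeProj (h.mk_zero_mem_tubeGood s)
  obtain ⟨δ, hδ, hδW⟩ := lebesgue_number_lemma_of_metric
    ((isCompact_Icc (a := (0 : ℝ)) (b := 1)).prod
      (isCompact_singleton (x := (0 : EuclideanSpace ℝ (Fin 2)))))
    (c := fun s => interior (W s)) (fun s => isOpen_interior) (by
      rintro ⟨s, u⟩ ⟨-, hu⟩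
      rw [mem_singleton_iff] at hu
      subst hu
      exact mem_iUnion.2 ⟨s, mem_interior_iff_mem_nhds.2 (hW s)⟩)
  refine ⟨δ, hδ, fun s => ?_⟩
  have key : ∀ s ∈ Icc (0 : ℝ) 1,
      InjOn (tubeProj k n₁ n₂) (ball ((s, 0) : ℝ × EuclideanSpace ℝ (Fin 2)) δ) := by
    intro s hs
    obtain ⟨i, hi⟩ := hδW (s, 0) ⟨hs, rfl⟩
    exact (hWinj i).mono (hi.trans interior_subset)
  -- translate the box at `s` to the box at `fract s ∈ [0, 1)`
  have hshift : ∀ x ∈ ball ((s, 0) : ℝ × EuclideanSpace ℝ (Fin 2)) δ,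
      ((x.1 - ⌊s⌋, x.2) : ℝ × EuclideanSpace ℝ (Fin 2)) ∈
        ball ((Int.fract s, 0) : ℝ × EuclideanSpace ℝ (Fin 2)) δ := by
    intro x hx
    rw [mem_ball, Prod.dist_eq] at hx ⊢
    have : dist (x.1 - ⌊s⌋) (Int.fract s) = dist x.1 s := by
      rw [Real.dist_eq, Real.dist_eq, Int.fract]
      congr 1
      ring
    rw [this]
    exact hx
  have hper : ∀ x : ℝ × EuclideanSpace ℝ (Fin 2),
      tubeProj k n₁ n₂ (x.1 - ⌊s⌋, x.2) = tubeProj k n₁ n₂ x := by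
    intro x
    have := h.tubeProj_add_int (x.1 - ⌊s⌋) ⌊s⌋ x.2
    rw [sub_add_cancel] at this
    exact this.symm
  intro x hx y hy hxy
  have := key (Int.fract s) ⟨Int.fract_nonneg s, (Int.fract_lt_one s).le⟩ (hshift x hx)
    (hshift y hy) (by rw [hper, hper, hxy])
  obtain ⟨h1, h2⟩ := Prod.mk.inj this
  exact Prod.ext (sub_left_injective h1) h2

/-- **Separation.** For a continuous `1`-periodic curve that identifies parameters exactly modulo
`ℤ` and any `δ > 0` there is `η > 0` such that parameters at distance `≤ 1/2` whose values are
`η`-close are `δ`-close (compactness of `{(s, s') ∈ [0, 1] × ℝ | δ ≤ |s - s'| ≤ 1/2}`, on which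
`‖k s - k s'‖` is positive). [folklore] -/
theorem exists_abs_sub_lt (hinj : ∀ s t, k s = k t → ∃ m : ℤ, s = t + m) {δ : ℝ} (hδ : 0 < δ) :
    ∃ η > 0, ∀ s s' : ℝ, |s - s'| ≤ 1 / 2 → ‖k s - k s'‖ < η → |s - s'| < δ := by
  have hcont : Continuous k := h.contDiff.continuous
  set P : Set (ℝ × ℝ) := {p | p.1 ∈ Icc (0 : ℝ) 1 ∧ δ ≤ |p.1 - p.2| ∧ |p.1 - p.2| ≤ 1 / 2}
    with hP_def
  have hPc : IsCompact P := by
    refine ((isCompact_Icc (a := (0 : ℝ)) (b := 1)).prod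
      (isCompact_Icc (a := -(1 / 2 : ℝ)) (b := 3 / 2))).of_isClosed_subset ?_ ?_
    · have hc : Continuous fun p : ℝ × ℝ => |p.1 - p.2| := (continuous_fst.sub continuous_snd).abs
      exact (isClosed_Icc.preimage continuous_fst).inter
        ((isClosed_le continuous_const hc).inter (isClosed_le hc continuous_const))
    · rintro ⟨a, b⟩ ⟨ha, -, hab⟩
      refine ⟨ha, ?_⟩
      rw [abs_le] at hab
      exact ⟨by linarith [ha.1, hab.2], by linarith [ha.2, hab.1]⟩
  have hg : Continuous fun p : ℝ × ℝ => ‖k p.1 - k p.2‖ :=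
    ((hcont.comp continuous_fst).sub (hcont.comp continuous_snd)).norm
  have hpos : ∀ p ∈ P, 0 < ‖k p.1 - k p.2‖ := by
    rintro ⟨a, b⟩ ⟨-, hab, hab'⟩
    refine norm_pos_iff.2 (sub_ne_zero.2 fun heq => ?_)
    obtain ⟨m, hm⟩ := hinj a b heq
    rw [hm, add_sub_cancel_left] at hab hab'
    have hm1 : |(m : ℝ)| < 1 := by linarith
    have hm0 : m = 0 := by
      rw [← Int.cast_abs] at hm1
      exact Int.abs_lt_one_iff.1 (by exact_mod_cast hm1)
    rw [hm0, Int.cast_zero, abs_zero] at hab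
    exact absurd hab (not_le.2 hδ)
  obtain ⟨η, hη, hηP⟩ : ∃ η > 0, ∀ p ∈ P, η ≤ ‖k p.1 - k p.2‖ := by
    rcases P.eq_empty_or_nonempty with hP | hP
    · exact ⟨1, one_pos, fun p hp => by rw [hP] at hp; exact hp.elim⟩
    · obtain ⟨p₀, hp₀, hmin⟩ := hPc.exists_isMinOn hP hg.continuousOn
      exact ⟨_, hpos p₀ hp₀, fun p hp => hmin hp⟩
  refine ⟨η, hη, fun s s' hss' hk => ?_⟩
  by_contra hcon
  have hle : δ ≤ |s - s'| := le_of_not_gt hcon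
  -- normalise `s` into `[0, 1)`
  have hab : Int.fract s - (s' - ⌊s⌋) = s - s' := by rw [Int.fract]; ring
  have hmem : ((Int.fract s, s' - ⌊s⌋) : ℝ × ℝ) ∈ P :=
    ⟨⟨Int.fract_nonneg s, (Int.fract_lt_one s).le⟩, by rw [hab]; exact hle, by rw [hab]; exact hss'⟩
  have h1 : k (Int.fract s) = k s := by
    have := h.apply_add_int (Int.fract s) ⌊s⌋
    rw [Int.fract_add_floor] at this
    exact this.symm
  have h2 : k (s' - ⌊s⌋) = k s' := by
    have := h.apply_add_int (s' - ⌊s⌋) ⌊s⌋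
    rw [sub_add_cancel] at this
    exact this.symm
  have := hηP _ hmem
  simp only [h1, h2] at this
  linarith

/-- **Thin tubes stay close to the core**: for `η > 0` there is `ε > 0` with `tubeFun (t, u) ≠ 0`
and `‖tubeProj (t, u) - k t‖ < η` whenever `‖u‖ < ε` (tube lemma on `[0, 1] × {0}` +
periodicity). [folklore] -/
theorem exists_forall_norm_tubeProj_sub_lt {η : ℝ} (hη : 0 < η) :
    ∃ ε > 0, ∀ (t : ℝ), ∀ u ∈ ball (0 : EuclideanSpace ℝ (Fin 2)) ε,
      tubeFun k n₁ n₂ (t, u) ≠ 0 ∧ ‖tubeProj k n₁ n₂ (t, u) - k t‖ < η := by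
  have hG := continuous_tubeFun h.contDiff h.contDiff₁ h.contDiff₂
  set O : Set (ℝ × EuclideanSpace ℝ (Fin 2)) := {q | tubeFun k n₁ n₂ q ≠ 0} ∩
    (fun q => tubeProj k n₁ n₂ q - k q.1) ⁻¹' ball (0 : EuclideanSpace ℝ (Fin 4)) η with hO_def
  have hU : IsOpen {q : ℝ × EuclideanSpace ℝ (Fin 2) | tubeFun k n₁ n₂ q ≠ 0} :=
    isOpen_compl_singleton.preimage hG
  have hO : IsOpen O := by
    refine ContinuousOn.isOpen_inter_preimage (fun q hq => ?_) hU isOpen_ball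
    exact ((continuousAt_tubeProj h.contDiff h.contDiff₁ h.contDiff₂ hq).sub
      ((h.contDiff.continuous.comp continuous_fst).continuousAt)).continuousWithinAt
  have hsub : Icc (0 : ℝ) 1 ×ˢ ({0} : Set (EuclideanSpace ℝ (Fin 2))) ⊆ O := by
    rintro ⟨t, u⟩ ⟨-, hu⟩
    rw [mem_singleton_iff] at hu
    subst hu
    have hk0 : k t ≠ 0 := fun h0 => by simpa [h0] using h.norm_eq t
    refine ⟨by rwa [mem_setOf_eq, tubeFun_zero], ?_⟩
    show tubeProj k n₁ n₂ (t, 0) - k t ∈ ball (0 : EuclideanSpace ℝ (Fin 4)) η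
    rw [h.tubeProj_zero, sub_self]
    exact mem_ball_self hη
  obtain ⟨U, V, -, hV, hsU, htV, hUV⟩ :=
    generalized_tube_lemma isCompact_Icc isCompact_singleton hO hsub
  obtain ⟨ε, hε, hεV⟩ := Metric.isOpen_iff.1 hV 0 (htV rfl)
  refine ⟨ε, hε, fun t u hu => ?_⟩
  obtain ⟨h1a, h1b⟩ : ((Int.fract t, u) : ℝ × EuclideanSpace ℝ (Fin 2)) ∈ O :=
    hUV ⟨hsU ⟨Int.fract_nonneg t, (Int.fract_lt_one t).le⟩, hεV hu⟩
  have e1 : tubeFun k n₁ n₂ (t, u) = tubeFun k n₁ n₂ (Int.fract t, u) := by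
    have := h.tubeFun_add_int (Int.fract t) ⌊t⌋ u
    rwa [Int.fract_add_floor] at this
  have e2 : tubeProj k n₁ n₂ (t, u) = tubeProj k n₁ n₂ (Int.fract t, u) := by
    have := h.tubeProj_add_int (Int.fract t) ⌊t⌋ u
    rwa [Int.fract_add_floor] at this
  have e3 : k t = k (Int.fract t) := by
    have := h.apply_add_int (Int.fract t) ⌊t⌋
    rwa [Int.fract_add_floor] at this
  refine ⟨by rw [e1]; exact h1a, ?_⟩
  rw [e2, e3]
  exact mem_ball_zero_iff.1 h1b

/-- **Tube radii exist** for a framed curve that identifies parameters exactly modulo `ℤ` (e.g. the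
framed curve of a knot): for `ε` below the good-slab radius, the uniform local-injectivity radius
`δ` and the closeness radius for `η / 2` (`η` the separation constant for `δ`), two parameters
`(t₁, u₁)`, `(t₂, u₂)` of the slab with the same image have — after shifting `t₂` by an integer into
`[t₁ - 1/2, t₁ + 1/2)` — `‖k t₁ - k t₂‖ < η`, hence `|t₁ - t₂| < δ`, hence coincide by local
injectivity. [folklore] -/
theorem exists_isTubeRadius (hinj : ∀ s t, k s = k t → ∃ m : ℤ, s = t + m) :
    ∃ ε, IsTubeRadius k n₁ n₂ ε := by
  obtain ⟨ε₀, hε₀, hgood⟩ := h.exists_ball_subset_tubeGood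
  obtain ⟨δ, hδ, hinjOn⟩ := h.exists_injOn_ball
  obtain ⟨η, hη, hsep⟩ := h.exists_abs_sub_lt hinj hδ
  obtain ⟨ε₁, hε₁, hclose⟩ := h.exists_forall_norm_tubeProj_sub_lt (half_pos hη)
  refine ⟨min ε₀ (min δ ε₁), lt_min hε₀ (lt_min hδ hε₁),
    fun t u hu => hgood t u (ball_subset_ball (min_le_left _ _) hu),
    fun t₁ t₂ u₁ u₂ hu₁ hu₂ heq => ?_⟩
  rw [mem_ball_zero_iff, lt_min_iff, lt_min_iff] at hu₁ hu₂
  have hu₁ε : u₁ ∈ ball (0 : EuclideanSpace ℝ (Fin 2)) ε₁ := mem_ball_zero_iff.2 hu₁.2.2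
  have hu₂ε : u₂ ∈ ball (0 : EuclideanSpace ℝ (Fin 2)) ε₁ := mem_ball_zero_iff.2 hu₂.2.2
  -- shift `t₂` into `[t₁ - 1/2, t₁ + 1/2)`
  set t₂' := toIcoMod one_pos (t₁ - 1 / 2) t₂ with ht₂'
  have hI := toIcoMod_mem_Ico one_pos (t₁ - 1 / 2) t₂
  rw [← ht₂'] at hI
  obtain ⟨m, hm⟩ : ∃ m : ℤ, t₂' = t₂ + m := by
    refine ⟨-toIcoDiv one_pos (t₁ - 1 / 2) t₂, ?_⟩
    rw [ht₂', ← self_sub_toIcoDiv_zsmul, zsmul_one, Int.cast_neg, sub_eq_add_neg]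
  have heq' : tubeProj k n₁ n₂ (t₂', u₂) = tubeProj k n₁ n₂ (t₂, u₂) := by
    rw [hm]
    exact h.tubeProj_add_int t₂ m u₂
  have habs : |t₁ - t₂'| ≤ 1 / 2 := by
    rw [abs_le]
    exact ⟨by linarith [hI.2], by linarith [hI.1]⟩
  have hnorm : ‖k t₁ - k t₂'‖ < η := by
    calc ‖k t₁ - k t₂'‖
        ≤ ‖k t₁ - tubeProj k n₁ n₂ (t₁, u₁)‖ + ‖tubeProj k n₁ n₂ (t₁, u₁) - k t₂'‖ :=
          norm_sub_le_norm_sub_add_norm_sub _ _ _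
      _ < η / 2 + η / 2 := by
          refine add_lt_add ?_ ?_
          · rw [norm_sub_rev]
            exact (hclose t₁ u₁ hu₁ε).2
          · rw [heq, ← heq']
            exact (hclose t₂' u₂ hu₂ε).2
      _ = η := add_halves η
  have hlt : |t₁ - t₂'| < δ := hsep t₁ t₂' habs hnorm
  have hx : ((t₁, u₁) : ℝ × EuclideanSpace ℝ (Fin 2)) ∈
      ball ((t₁, 0) : ℝ × EuclideanSpace ℝ (Fin 2)) δ := by
    rw [mem_ball, Prod.dist_eq, dist_self, dist_zero_right]
    exact max_lt hδ hu₁.2.1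
  have hy : ((t₂', u₂) : ℝ × EuclideanSpace ℝ (Fin 2)) ∈
      ball ((t₁, 0) : ℝ × EuclideanSpace ℝ (Fin 2)) δ := by
    rw [mem_ball, Prod.dist_eq, Real.dist_eq, dist_zero_right, abs_sub_comm]
    exact max_lt hlt hu₂.2.1
  obtain ⟨e1, e2⟩ := Prod.mk.inj (hinjOn t₁ hx hy (heq.trans heq'.symm))
  exact ⟨⟨m, e1.trans hm⟩, e2⟩

end IsFramedCurve

end TubeRadius

/-! ## Descent to `S¹ × ℝ²` -/

section Descent

variable {k n₁ n₂ : ℝ → EuclideanSpace ℝ (Fin 4)} {ε : ℝ}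

/-- The radial tube map of a framed curve only depends on the point of the circle:
`circlePt s = circlePt t → tubeProj (s, u) = tubeProj (t, u)`. [folklore] -/
theorem IsFramedCurve.tubeProj_eq_of_circlePt_eq (h : IsFramedCurve k n₁ n₂) {s t : ℝ}
    (hst : circlePt s = circlePt t) (u : EuclideanSpace ℝ (Fin 2)) :
    tubeProj k n₁ n₂ (s, u) = tubeProj k n₁ n₂ (t, u) := by
  obtain ⟨m, rfl⟩ := circlePt_eq_circlePt_iff.1 hst
  exact h.tubeProj_add_int t m u

/-- The descended tube map may be computed with any section of `circlePt` in place of `angA`.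
[folklore] -/
theorem IsFramedCurve.tubeMap_eq_of_circlePt_eq (h : IsFramedCurve k n₁ n₂)
    {ang : (Metric.sphere (0 : EuclideanSpace ℝ (Fin 2)) 1) → ℝ}
    {z : (Metric.sphere (0 : EuclideanSpace ℝ (Fin 2)) 1)}
    (hz : circlePt (ang z) = z) (u : EuclideanSpace ℝ (Fin 2)) :
    tubeMap k n₁ n₂ ε (z, u) =
      tubeProj k n₁ n₂
        (ang z, OpenPartialHomeomorph.univBall (0 : EuclideanSpace ℝ (Fin 2)) ε u) := by
  rw [tubeMap_apply]
  exact h.tubeProj_eq_of_circlePt_eq (by rw [circlePt_angA, hz]) _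

namespace IsTubeRadius

variable (hε : IsTubeRadius k n₁ n₂ ε)
include hε

/-- `univBall 0 ε` takes values in `B(0, ε)`. [folklore] -/
theorem univBall_mem_ball (u : EuclideanSpace ℝ (Fin 2)) :
    OpenPartialHomeomorph.univBall (0 : EuclideanSpace ℝ (Fin 2)) ε u ∈
      ball (0 : EuclideanSpace ℝ (Fin 2)) ε := by
  have := (OpenPartialHomeomorph.univBall (0 : EuclideanSpace ℝ (Fin 2)) ε).map_source (x := u)
    (by rw [OpenPartialHomeomorph.univBall_source]; exact mem_univ u)
  rwa [OpenPartialHomeomorph.univBall_target _ hε.pos] at this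

/-- The parameters fed to `tubeProj` by the descended tube map are good. [folklore] -/
theorem mem_tubeGood'
    (x : (Metric.sphere (0 : EuclideanSpace ℝ (Fin 2)) 1) × EuclideanSpace ℝ (Fin 2)) :
    ((angA x.1, OpenPartialHomeomorph.univBall (0 : EuclideanSpace ℝ (Fin 2)) ε x.2) :
      ℝ × EuclideanSpace ℝ (Fin 2)) ∈ tubeGood k n₁ n₂ :=
  hε.mem_tubeGood _ _ (hε.univBall_mem_ball x.2)

/-- The descended tube map takes values on the unit sphere `S³`. [folklore] -/
theorem norm_tubeMap
    (x : (Metric.sphere (0 : EuclideanSpace ℝ (Fin 2)) 1) × EuclideanSpace ℝ (Fin 2)) :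
    ‖tubeMap k n₁ n₂ ε x‖ = 1 :=
  norm_tubeProj (hε.mem_tubeGood' x).1

/-- **The descended tube map is injective**: equal images force parameters equal modulo `ℤ × 0`
(`IsTubeRadius.eq_of_tubeProj_eq`), hence equal points of `S¹ × ℝ²`. [folklore] -/
theorem tubeMap_injective : Injective (tubeMap k n₁ n₂ ε) := by
  rintro ⟨z, u⟩ ⟨z', u'⟩ hxy
  rw [tubeMap_apply, tubeMap_apply] at hxy
  obtain ⟨⟨m, hm⟩, huu⟩ := hε.eq_of_tubeProj_eq _ _ _ _ (hε.univBall_mem_ball u)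
    (hε.univBall_mem_ball u') hxy
  have hz : z = z' := by
    rw [← circlePt_angA z, ← circlePt_angA z', hm, circlePt_add_int]
  have hu : u = u' :=
    (OpenPartialHomeomorph.univBall (0 : EuclideanSpace ℝ (Fin 2)) ε).injOn
      (by rw [OpenPartialHomeomorph.univBall_source]; exact mem_univ u)
      (by rw [OpenPartialHomeomorph.univBall_source]; exact mem_univ u') huu
  rw [hz, hu]

variable (h : IsFramedCurve k n₁ n₂)
include h

/-- **The descended tube map is continuous**: near `z ≠ (1, 0)` compute it with the section `angA`,
near `z = (1, 0)` with `angB`; both are continuous there (`TorusCoordinates.lean`). [folklore] -/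
theorem continuous_tubeMap : Continuous (tubeMap k n₁ n₂ ε) := by
  rw [continuous_iff_continuousAt]
  rintro ⟨z, u⟩
  obtain ⟨ang, hang, hsec⟩ :
      ∃ ang : (Metric.sphere (0 : EuclideanSpace ℝ (Fin 2)) 1) → ℝ,
        ContinuousAt ang z ∧ ∀ z', circlePt (ang z') = z' := by
    by_cases hA : z = ptA
    · exact ⟨angB, (contMDiffAt_angB (hA ▸ ptA_ne_ptB)).continuousAt, circlePt_angB⟩
    · exact ⟨angA, (contMDiffAt_angA hA).continuousAt, circlePt_angA⟩
  have hfun : tubeMap k n₁ n₂ ε = (tubeProj k n₁ n₂) ∘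
      fun x : (Metric.sphere (0 : EuclideanSpace ℝ (Fin 2)) 1) × EuclideanSpace ℝ (Fin 2) =>
        ((ang x.1, OpenPartialHomeomorph.univBall (0 : EuclideanSpace ℝ (Fin 2)) ε x.2) :
          ℝ × EuclideanSpace ℝ (Fin 2)) :=
    funext fun x => h.tubeMap_eq_of_circlePt_eq (hsec x.1) x.2
  rw [hfun]
  have hgood := hε.mem_tubeGood (ang z) _ (hε.univBall_mem_ball u)
  refine ContinuousAt.comp (continuousAt_tubeProj h.contDiff h.contDiff₁ h.contDiff₂ hgood.1) ?_
  exact (hang.comp continuousAt_fst).prodMk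
    ((OpenPartialHomeomorph.continuous_univBall (0 : EuclideanSpace ℝ (Fin 2)) ε).continuousAt.comp
      continuousAt_snd)

/-- **The descended tube map is open into the sphere**: the image of every neighbourhood of `x`
contains a neighbourhood of the image point intersected with `S³`. Pull the neighbourhood back along
the continuous local inverse `(s, v) ↦ (circlePt s, (univBall 0 ε)⁻¹ v)` of the parametrisation and
apply `IsFramedCurve.exists_nhds_inter_sphere_subset_image`. [folklore] -/
theorem exists_nhds_inter_sphere_subset_image_tubeMap
    (x : (Metric.sphere (0 : EuclideanSpace ℝ (Fin 2)) 1) × EuclideanSpace ℝ (Fin 2))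
    {N : Set ((Metric.sphere (0 : EuclideanSpace ℝ (Fin 2)) 1) × EuclideanSpace ℝ (Fin 2))}
    (hN : N ∈ 𝓝 x) :
    ∃ V ∈ 𝓝 (tubeMap k n₁ n₂ ε x),
      V ∩ sphere (0 : EuclideanSpace ℝ (Fin 4)) 1 ⊆ tubeMap k n₁ n₂ ε '' N := by
  obtain ⟨z, u⟩ := x
  set φ := OpenPartialHomeomorph.univBall (0 : EuclideanSpace ℝ (Fin 2)) ε with hφ
  have hφu : φ u ∈ ball (0 : EuclideanSpace ℝ (Fin 2)) ε := hε.univBall_mem_ball u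
  set Λ : ℝ × EuclideanSpace ℝ (Fin 2) →
      (Metric.sphere (0 : EuclideanSpace ℝ (Fin 2)) 1) × EuclideanSpace ℝ (Fin 2) :=
    fun q => (circlePt q.1, φ.symm q.2) with hΛ_def
  have hΛ : ContinuousAt Λ (angA z, φ u) := by
    refine (continuous_circlePt.continuousAt.comp continuousAt_fst).prodMk ?_
    have : ContinuousAt φ.symm (φ u) :=
      (OpenPartialHomeomorph.continuousOn_univBall_symm (0 : EuclideanSpace ℝ (Fin 2))
        ε).continuousAt (isOpen_ball.mem_nhds hφu)
    exact this.comp_of_eq continuousAt_snd rfl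
  have hΛx : Λ (angA z, φ u) = (z, u) := by
    simp only [hΛ_def, circlePt_angA]
    rw [φ.left_inv (by rw [hφ, OpenPartialHomeomorph.univBall_source]; exact mem_univ u)]
  have hN' : Λ ⁻¹' N ∩ univ ×ˢ ball (0 : EuclideanSpace ℝ (Fin 2)) ε ∈
      𝓝 ((angA z, φ u) : ℝ × EuclideanSpace ℝ (Fin 2)) := by
    refine inter_mem (hΛ.preimage_mem_nhds (by rw [hΛx]; exact hN)) ?_
    exact (isOpen_univ.prod isOpen_ball).mem_nhds ⟨mem_univ _, hφu⟩
  obtain ⟨V, hV, hVsub⟩ := h.exists_nhds_inter_sphere_subset_image (hε.mem_tubeGood' (z, u)) hN'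
  refine ⟨V, hV, hVsub.trans ?_⟩
  rintro _ ⟨⟨s, v⟩, ⟨hsv, -, hv⟩, rfl⟩
  refine ⟨Λ (s, v), hsv, ?_⟩
  show tubeMap k n₁ n₂ ε (circlePt s, φ.symm v) = tubeProj k n₁ n₂ (s, v)
  rw [tubeMap_apply, ← hφ,
    φ.right_inv (by rw [hφ, OpenPartialHomeomorph.univBall_target _ hε.pos]; exact hv)]
  exact h.tubeProj_eq_of_circlePt_eq (circlePt_angA _) v

end IsTubeRadius

/-- **Embedded framed curves on `S³` have topological tubular neighbourhoods.** If `(k, n₁, n₂)` is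
a framed regular closed curve on `S³` identifying parameters exactly modulo `ℤ`, there is a
continuous injective open map `ν : S¹ × ℝ² → S³` with `ν (z, 0) = k (angA z)` (i.e.
`ν (circlePt t, 0) = k t`): the descended tube map for a tube radius, viewed in the sphere.
[folklore] -/
theorem IsFramedCurve.exists_tube (h : IsFramedCurve k n₁ n₂)
    (hinj : ∀ s t, k s = k t → ∃ m : ℤ, s = t + m) :
    ∃ ν : (Metric.sphere (0 : EuclideanSpace ℝ (Fin 2)) 1) × EuclideanSpace ℝ (Fin 2) →
        (Metric.sphere (0 : EuclideanSpace ℝ (Fin 4)) 1),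
      Continuous ν ∧ Injective ν ∧ IsOpenMap ν ∧
        ∀ z, (ν (z, 0) : EuclideanSpace ℝ (Fin 4)) = k (angA z) := by
  obtain ⟨ε, hε⟩ := h.exists_isTubeRadius hinj
  set ν : (Metric.sphere (0 : EuclideanSpace ℝ (Fin 2)) 1) × EuclideanSpace ℝ (Fin 2) →
      (Metric.sphere (0 : EuclideanSpace ℝ (Fin 4)) 1) :=
    fun x => ⟨tubeMap k n₁ n₂ ε x, mem_sphere_zero_iff_norm.2 (hε.norm_tubeMap x)⟩ with hν
  refine ⟨ν, (hε.continuous_tubeMap h).subtype_mk _,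
    fun x y hxy => hε.tubeMap_injective (congrArg Subtype.val hxy), ?_, fun z => h.tubeMap_zero ε z⟩
  rw [isOpenMap_iff_nhds_le]
  intro x T hT
  obtain ⟨V, hV, hVsub⟩ := hε.exists_nhds_inter_sphere_subset_image_tubeMap h x hT
  rw [mem_nhds_subtype]
  refine ⟨V, hV, fun y hy => ?_⟩
  obtain ⟨x', hx', hx'y⟩ := hVsub ⟨hy, y.2⟩
  have : ν x' = y := Subtype.ext hx'y
  rw [← this]
  exact hx'

end Descent

/-! ## Knots: tubes, finite generation, `Δ_K(1) = ±1` -/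

section KnotAssembly

/-- **Every smooth knot is a framed curve**: `K.curve` with the normal framing of
`exists_normal_framing` (`KnotFraming.lean`). [folklore] -/
theorem Knot.exists_isFramedCurve (K : Knot) :
    ∃ n₁ n₂ : ℝ → EuclideanSpace ℝ (Fin 4), IsFramedCurve K.curve n₁ n₂ := by
  obtain ⟨n₁, n₂, h₁, h₂, hp₁, hp₂, hall⟩ :=
    exists_normal_framing K.contDiff_curve K.periodic_curve K.norm_curve K.deriv_curve_ne_zero
  exact ⟨n₁, n₂,
    { contDiff := K.contDiff_curve
      contDiff₁ := h₁
      contDiff₂ := h₂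
      periodic := K.periodic_curve
      periodic₁ := hp₁
      periodic₂ := hp₂
      norm_eq := K.norm_curve
      deriv_ne := K.deriv_curve_ne_zero
      ne₁ := fun t => (hall t).2.2.2.2.2.1
      ne₂ := fun t => (hall t).2.2.2.2.2.2
      inner₁ := fun t => (hall t).1
      inner₂ := fun t => (hall t).2.1
      inner₁' := fun t => (hall t).2.2.1
      inner₂' := fun t => (hall t).2.2.2.1
      inner₁₂ := fun t => (hall t).2.2.2.2.1 }⟩

/-- **Topological tubular neighbourhood theorem for smooth knots in `S³`.** Every smooth knot
`K : S¹ → S³` is the core of a topological tube: there is a continuous injective open map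
`ν : S¹ × ℝ² → S³` with `ν (z, 0) = K z`. (The smooth version, with `ν` a smooth orientation
compatible embedding, is the named fact `Knot.nonempty_tubularNbhd` of `DehnSurgery.lean`; the
topological version proved here is what the knot-group argument consumes.) Hirsch (1976), §4.5
(tubular neighbourhood theorem). [folklore] -/
theorem Knot.exists_tube (K : Knot) :
    ∃ ν : (Metric.sphere (0 : EuclideanSpace ℝ (Fin 2)) 1) × EuclideanSpace ℝ (Fin 2) →
        (Metric.sphere (0 : EuclideanSpace ℝ (Fin 4)) 1),
      Continuous ν ∧ Injective ν ∧ IsOpenMap ν ∧ ∀ z, ν (z, 0) = K z := by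
  obtain ⟨n₁, n₂, h⟩ := K.exists_isFramedCurve
  obtain ⟨ν, hc, hi, ho, h0⟩ := h.exists_tube fun s t => (K.curve_eq_curve_iff).1
  exact ⟨ν, hc, hi, ho, fun z => Subtype.ext (by rw [h0, Knot.curve_apply, circlePt_angA])⟩

/-- **Knot groups are finitely generated** — discharge of the named fact `Literature.Topology.FourManifolds.Knot.fg_group`
(`KnotGroupProofs.lean`): `fundamentalGroup_fg_compl_range_of_tube` (`KnotGroupTubular.lean`)
applied to the tube of `Knot.exists_tube`. Crowell–Fox, Ch. VI (2.5) with Ch. I (2.1).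
[cite: CrowellFox1963, Ch. VI (2.5)] -/
theorem Knot.fg_group_holds : Knot.fg_group := fun K x => by
  obtain ⟨ν, hc, hi, ho, h0⟩ := K.exists_tube
  exact fundamentalGroup_fg_compl_range_of_tube hc hi ho h0 x

/-- **`Δ_K(1) = ±1` for every knot** — discharge of the named fact
`Literature.Topology.FourManifolds.Knot.IsAlexanderPolynomial.isUnit_eval_one` (`KnotGroup.lean`): every Alexander polynomial
`Δ` of a smooth knot `K ⊆ S³` (a generator of the order ideal of the Alexander module of the knot
group) satisfies `IsUnit (Δ(1))` in `ℤ`. Assembled from `Knot.fg_group_holds` and the algebraic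
theorem `Knot.IsAlexanderPolynomial.isUnit_eval_one_of_fg_group` (`KnotGroupProofs.lean`, resting
on `AlexanderModuleTrivializer.lean`: Crowell–Fox Ch. IX (1.2), the trivialiser kills the
elementary ideals of a finitely generated group with infinite cyclic abelianisation).
[cite: CrowellFox1963, Ch. IX (1.1)–(1.2)] -/
theorem Knot.IsAlexanderPolynomial.isUnit_eval_one_holds :
    Knot.IsAlexanderPolynomial.isUnit_eval_one :=
  Knot.IsAlexanderPolynomial.isUnit_eval_one_of_fg_group Knot.fg_group_holds

end KnotAssembly

end Literature.Topology.FourManifolds
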